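import Mathlib
import Summits.QuantumFields.YangMills.Theorems.BalabanUVNodesN15BackgroundModel
import HarnessLib

/-!
# Route «BalabanUVNodes» (cluster K4 «SpineRates»), Track-A DAG node N15 = spine estimate NE2, BACKGROUND LAYER — THE BACKGROUND-DEPENDENT
# PROPAGATOR CONSTRUCTED FROM A BLOCK MAJORANT, WITH DECAY, ON ANY [B6] CARRIER: `X(c) = (1 − G∘M_c)⁻¹G`, (3.65) BY CONSTRUCTION, its Neumann
# majorant, and the η-defect `𝔇(X′(c′), X(avg c′))` of the PAIR from the `U ≡ 1` layer + the (3.35) LETTER PAIR of the fine coefficient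

Cell `pub-ymgap`, seat `pub-ymgap-dag-n15-b` (generation g5; FIRST-MISSING-ESTIMATE, HUMAN RULING D-0062; chair R424 venue; ROSTER-D0062 l.26).
`bears_on: R4∕N15`.  Filed `--supports stmt-QuantumFields-19351` (helper).  Imports this seat's S6 `…N15.BackgroundModel` (`neumannSol`,
`kappa_ofBlocks`) and through it g0's `…N15.BackgroundStep.idef_background_propagator_majorant_flat`, `…N15.DerivDefect` (`exists_const_hasMaj_ofBlocks`,
`sum_mul_diagK`), the cell record's `T4EtaRateCoeffDefect` (`pull`, `FibreOsc`, `blockAvg`, `fit_blockAvg`, `hasMaj_idef_mulOp_blockAvg`) and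
`B9SectDWeightedNeumann` (`wrow_of_exp`, `neumann_majorant_wrow`) BY NAME; nothing in the tree is modified.

WHY (the located gap, ref-B READ #323 ∕ #335, INBOX l.11794, on the -a readouts): every by-name `T4EtaRate.NE2PlusOperator` in the tree sits at the
one-point background carrier `pt9Bg` — the «+» block is inert.  The -b lineage reduced NE2⁺-LOCAL to NE2⁰ + letters (`idef_background_propagator_majorant`)
and INHABITED the background step once (S6, zero-range windows, no decay, entrywise row sums — constants tied to the window), but never CONSTRUCTED the
background-dependent pair over a carrier with decay in a form a by-name readout can consume.  THIS FILE does that, on ANY [B6] carrier; the sequel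
`BalabanUVNodesN15BackgroundLayerByName` reads it out with the background block LIVE.

THE PRINT (MECHANISM and SHAPES only; nothing of [B9] asserted).  [Balaban1985BackgroundPropagators] (3.62)–(3.65) pp. 402–403 (verbatim in the tree
header `B9Thm34Ext`): *«the operator V′(A)G′(U) satisfies the bound |(V′(A)G′(U)λ)(x)| ≦ O(1)B₀α₁e^{−δ₀d(y,y′)} (3.63) … I − V′(A)G′(U) is an invertible
operator, the inverse is given by a convergent Neumann series … (3.64) … G′(U′U) = G′(U) + G′(U)V′(A)G′(U′U) (3.65)»*; (3.35) p. 396: *«|A| < O(1)Mα₀(L^jη)^{−1},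
|∇^ηA| < O(1)Mα₀(L^jη)^{−2} on □»* — here the LETTER PAIR of the fine coefficient `c′`: the sup letter `|c′| ≤ r` and the within-block oscillation letter
`T4EtaRateCoeffDefect.FibreOsc π c′ o` (on `ℤ^d` ∕ tori the oscillation letter follows from the bond letter with `o = d(M − 1)·θ₁`, parts 12a∕12d
`fit_blockMean(T)`, `T4EtaRateCoeffDefect.osc_of_inBlockBondBound` — ONE rate factor).

CONTENTS ([folklore]: finite-dimensional linear algebra + the lineage's lemmas BY NAME).
* §1 SUP-NORM CONTRACTION FROM A BLOCK MAJORANT: `abs_apply_le_of_hasMaj` (a block majorant `N ≥ 0` with row sums `≤ q` bounds `|Tv(x)| ≤ q·sup|v|` —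
  NO entrywise row sums, NO fibre counts, so the contraction is uniform in the block population), `eq_zero_of_apply_eq_self`, `isUnit_one_sub_toMatrix'`
  (`1 − [T]` a unit when `q < 1`: `Matrix.mulVec_injective_iff_isUnit`).
* §2 THE CONSTRUCTED PROPAGATOR `bgProp G c := (neumannSol [G∘M_c] [G]).mulVecLin` (S6's `neumannSol T K = (1 − T)⁻¹K` on `LinearMap.toMatrix'`),
  `bgProp_fix` ((3.65) BY CONSTRUCTION under the unit hypothesis), `hasMaj_step` (the step `G∘M_c ≤ β·r·e^{−δd}` from `G ≤ β·e^{−δd}` and `|c| ≤ r`),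
  `isUnit_step` (unit when `β·r·c_r < 1`, `c_r` the (2.61) row-sum constant at a rate `σ ≤ δ`), `hasMaj_bgProp` (Neumann WITH DECAY:
  `X(c) ≤ β(1 − βrc_r)⁻¹·e^{−ρd}` for `ρ + σ ≤ δ`), `hasMaj_mulOp_bgProp` (the coarse `M_cX ≤ rβ(1 − βrc_r)⁻¹e^{−ρd}` — binder (c) of g0's step).
* §3 THE COEFFICIENTS: `abs_blockAvg_le` (the block average keeps the sup letter), `hasMaj_sandwich_blockAvg` (binder (d) of g0's step DISCHARGED from the
  oscillation letter: `G′ ∘ 𝔇(M_{c′}, M_{avg c′}) ∘ X ≤ β·o·A_X·c_r·e^{−ρd}`).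
* §4 **`hasMaj_idef_bgProp`** — THE η-DEFECT OF THE CONSTRUCTED PAIR: on any [B6] carrier ((2.54), `d ≥ 0`, (2.61) at `σ` with `c_r`), coarse lattice
  `X` blocked by `blk`, fine lattice `X′` paired by `π : X′ → X` and blocked through the pairing, `U ≡ 1` pieces `G`, `G′` with block majorants `β·e^{−δd}`
  and DEFECT majorant `𝔇(G′, G) ≤ m_G·e^{−δd}` (the -a layer — a binder here), fine coefficient `c′` with `|c′| ≤ r` and `FibreOsc π c′ o`, rate window
  `0 ≤ ρ`, `ρ + σ ≤ δ`, smallness `q = β·r·c_r < 1`: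
  `𝔇(X′(c′), X(blockAvg π c′)) ≤ (m_G·c_r·(1 + r·β(1−q)⁻¹) + β·o·β(1−q)⁻¹·c_r)·(1−q)⁻¹·e^{−ρd}` — g0's `idef_background_propagator_majorant_flat` with
  EVERY binder discharged except the `U ≡ 1` layer `(β, δ, m_G)`; `m_G` and `o` are the only small quantities (one rate factor each, as the record says).

HONEST FRAMING ∕ LIMITS.  MECHANISM + finite-dimensional linear algebra over hypothesis-shaped data: the `U ≡ 1` pieces and their defect are BINDERS
(inhabited with decay and uniform constants on the unit torus by -a parts 9∕10∕15 `hasMaj_idef_vectorPiece(_unitTorus)` ∕ `hasMaj_entry0`, and on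
zero-range windows by g0 file 10); scalar coefficients, ZEROTH-order perturbation species `M_c` (the first-order `V′₁(A)` species are parts 4∕17∕18∕19 —
not here); LINEARISED background transport (block average, convention (C3) of the record linearised); nothing about Bałaban's `G(U)` of [B6]∕[B9] is
asserted.  NE2⁺ NOT PRINTED, NOT proved; count-neutral (typed 28∕28; nothing discharged); N15 NOT discharged; one finite lattice at fixed ε — NOT infinite
volume, NOT OS on ℝ⁴, NOT a mass gap, NOT Clay.
-/

noncomputable section

namespace Summit.QuantumFields.YangMills.BalabanUVNodes.N15.BackgroundLayer

open Literature.MathematicalPhysics.QuantumFieldTheory.Balaban1983to89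
open Literature.MathematicalPhysics.QuantumFieldTheory.Balaban1983to89.B11SectG (BlockNorm HasMaj hasMaj_comp hasMaj_comp_exp RowSum)
open Literature.MathematicalPhysics.QuantumFieldTheory.Balaban1983to89.T4EtaRateDefect (idef)
open Literature.MathematicalPhysics.QuantumFieldTheory.Balaban1983to89.T4EtaRateCoeffDefect (pull pull_apply diagK diagK_nonneg FibreOsc fibre
  mem_fibre blockAvg fit_blockAvg hasMaj_mulOp hasMaj_idef_mulOp_blockAvg)
open Literature.MathematicalPhysics.QuantumFieldTheory.Balaban1983to89.B9SectDWeightedNeumann (WRow wrow_of_exp neumann_majorant_wrow)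
open Literature.MathematicalPhysics.QuantumFieldTheory.Balaban1983to89.B6RandomWalk (Triangle254)
open Literature.MathematicalPhysics.QuantumFieldTheory.Balaban1983to89.B6Prop26Gluing (mulOp mulOp_apply)
open Literature.MathematicalPhysics.QuantumFieldTheory.Balaban1983to89.B11AxialTransport190 (abs_le_loc_ofBlocks loc_ofBlocks_le)
open Summit.QuantumFields.YangMills.BalabanUVNodes.N15.DerivDefect (sum_mul_diagK sum_diagK_mul exists_const_hasMaj_ofBlocks)
open Summit.QuantumFields.YangMills.BalabanUVNodes.N15.BackgroundModel (neumannSol kappa_ofBlocks)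
open Summit.QuantumFields.YangMills.BalabanUVNodes.N15.BackgroundStep (idef_background_propagator_majorant_flat)

/-! ## §1 Sup-norm contraction from a block majorant -/

section Contraction

variable {g : B6.Geometry} {X X₂ : Type} [Fintype X] [Fintype X₂] (blk : X → g.Site) (blk₂ : X₂ → g.Site)

/-- The sup of `|v|` over a finite lattice bounds every value. [folklore] -/
theorem abs_le_iSup_abs (v : X → ℝ) (x : X) : |v x| ≤ ⨆ z : X, |v z| :=
  le_ciSup (Finite.bddAbove_range fun z => |v z|) x

/-- Every block size of `v` is below the sup of `|v|`. [folklore] -/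
theorem loc_le_iSup_abs (v : X → ℝ) (y : g.Site) : (BlockNorm.ofBlocks g blk).loc y v ≤ ⨆ z : X, |v z| :=
  loc_ofBlocks_le blk v (Real.iSup_nonneg fun z => abs_nonneg (v z)) fun x _ => abs_le_iSup_abs v x

/-- **SUP-NORM BOUND FROM A BLOCK MAJORANT.**  If `T` has a block majorant `N ≥ 0` between the sharp block norms and the row sums of `N` are `≤ q`,
then `|T v (x)| ≤ q · sup|v|` for every `v` and `x` — through the partition of unity of the source space (`HasMaj.bound`); no entrywise row sum and no
fibre count enter. [cite: Balaban1984PropagatorsII, (2.52)–(2.53) p.232 (majorant ⇒ operator-norm bound)] -/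
theorem abs_apply_le_of_hasMaj {T : (X → ℝ) →ₗ[ℝ] (X₂ → ℝ)} {N : g.Site → g.Site → ℝ} {q : ℝ}
    (h : HasMaj (BlockNorm.ofBlocks g blk) (BlockNorm.ofBlocks g blk₂) T N) (hN : ∀ y y', 0 ≤ N y y')
    (hrow : ∀ y, ∑ y', N y y' ≤ q) (v : X → ℝ) (x : X₂) : |T v x| ≤ q * ⨆ z : X, |v z| := by
  set S : ℝ := ⨆ z : X, |v z| with hS
  have hS0 : 0 ≤ S := Real.iSup_nonneg fun z => abs_nonneg (v z)
  have h1 : |T v x| ≤ (BlockNorm.ofBlocks g blk₂).loc (blk₂ x) (T v) := abs_le_loc_ofBlocks blk₂ (T v) rfl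
  have h2 := h.bound hN v (blk₂ x)
  refine h1.trans (h2.trans ?_)
  calc ∑ y', N (blk₂ x) y' * ((BlockNorm.ofBlocks g blk).κ * (BlockNorm.ofBlocks g blk).loc y' v)
      ≤ ∑ y', N (blk₂ x) y' * S := Finset.sum_le_sum fun y' _ => by
        rw [kappa_ofBlocks, one_mul]
        exact mul_le_mul_of_nonneg_left (loc_le_iSup_abs blk v y') (hN _ _)
    _ = (∑ y', N (blk₂ x) y') * S := by rw [Finset.sum_mul]
    _ ≤ q * S := mul_le_mul_of_nonneg_right (hrow _) hS0

variable {blk}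

/-- SUP-NORM CONTRACTION: with `q < 1`, `T v = v ⟹ v = 0`. [folklore] -/
theorem eq_zero_of_apply_eq_self {T : (X → ℝ) →ₗ[ℝ] (X → ℝ)} {N : g.Site → g.Site → ℝ} {q : ℝ}
    (h : HasMaj (BlockNorm.ofBlocks g blk) (BlockNorm.ofBlocks g blk) T N) (hN : ∀ y y', 0 ≤ N y y')
    (hrow : ∀ y, ∑ y', N y y' ≤ q) (hq : q < 1) {v : X → ℝ} (hv : T v = v) : v = 0 := by
  rcases isEmpty_or_nonempty X with hX | hX
  · funext x; exact (IsEmpty.false x).elim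
  set S : ℝ := ⨆ z : X, |v z| with hS
  have hS0 : 0 ≤ S := Real.iSup_nonneg fun z => abs_nonneg (v z)
  obtain ⟨x₀⟩ := hX
  have hq0 : 0 ≤ q := (Finset.sum_nonneg fun y' _ => hN (blk x₀) y').trans (hrow (blk x₀))
  have hle : S ≤ q * S := by
    refine Real.iSup_le (fun x => ?_) (mul_nonneg hq0 hS0)
    have := abs_apply_le_of_hasMaj blk blk h hN hrow v x
    rwa [hv] at this
  have hS00 : S = 0 := by nlinarith
  funext x
  have hx := abs_le_iSup_abs v x
  rw [← hS, hS00] at hx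
  exact abs_eq_zero.1 (le_antisymm hx (abs_nonneg _))

variable [DecidableEq X]

/-- `1 − [T]` IS A UNIT under the sup-norm contraction (`Matrix.mulVec_injective_iff_isUnit`) — the model's (3.63) ⟹ (3.64).
[cite: Balaban1985BackgroundPropagators, (3.63)–(3.64) pp.402–403 (mechanism)] -/
theorem isUnit_one_sub_toMatrix' {T : (X → ℝ) →ₗ[ℝ] (X → ℝ)} {N : g.Site → g.Site → ℝ} {q : ℝ}
    (h : HasMaj (BlockNorm.ofBlocks g blk) (BlockNorm.ofBlocks g blk) T N) (hN : ∀ y y', 0 ≤ N y y')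
    (hrow : ∀ y, ∑ y', N y y' ≤ q) (hq : q < 1) : IsUnit (1 - LinearMap.toMatrix' T) := by
  refine Matrix.mulVec_injective_iff_isUnit.1 fun v w hvw => ?_
  have h1 : ∀ u : X → ℝ, (1 - LinearMap.toMatrix' T).mulVec u = u - T u := fun u => by
    rw [Matrix.sub_mulVec, Matrix.one_mulVec, LinearMap.toMatrix'_mulVec]
  have h2 : T (v - w) = v - w := by
    have h3 := hvw
    rw [h1, h1, sub_eq_sub_iff_sub_eq_sub] at h3
    rw [map_sub]
    exact h3.symm
  exact sub_eq_zero.1 (eq_zero_of_apply_eq_self h hN hrow hq h2)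

end Contraction

/-! ## §2 The constructed background-dependent propagator -/

section Propagator

variable {g : B6.Geometry} {X : Type} [Fintype X] [DecidableEq X] (blk : X → g.Site)

/-- (3.65) for S6's `neumannSol` under a UNIT hypothesis (no row sums): `X = K + T·X`. [cite: Balaban1985BackgroundPropagators, (3.65) p.403 (shape)] -/
theorem neumannSol_fix_of_isUnit {T : Matrix X X ℝ} (hT : IsUnit (1 - T)) (K : Matrix X X ℝ) :
    neumannSol T K = K + T * neumannSol T K := by
  have h : (1 - T) * neumannSol T K = K := by
    unfold neumannSol
    rw [← Matrix.mul_assoc, Matrix.mul_nonsing_inv _ ((Matrix.isUnit_iff_isUnit_det _).1 hT), Matrix.one_mul]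
  rw [Matrix.sub_mul, Matrix.one_mul, sub_eq_iff_eq_add] at h
  exact h

/-- THE CONSTRUCTED BACKGROUND-DEPENDENT PROPAGATOR `X(c) = (1 − G∘M_c)⁻¹G` of a `U ≡ 1` piece `G` and a coefficient `c` (the zeroth-order perturbation
species `V = M_c`), as a linear map. [cite: Balaban1985BackgroundPropagators, (3.64) p.403 (shape: `G′(U′U) = G′(U)(I − V′(A)G′(U))⁻¹`)] -/
def bgProp (G : (X → ℝ) →ₗ[ℝ] (X → ℝ)) (c : X → ℝ) : (X → ℝ) →ₗ[ℝ] (X → ℝ) :=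
  (neumannSol (LinearMap.toMatrix' (G ∘ₗ mulOp c)) (LinearMap.toMatrix' G)).mulVecLin

/-- A matrix read back as a linear map is the original map. [folklore] -/
theorem mulVecLin_toMatrix' (T : (X → ℝ) →ₗ[ℝ] (X → ℝ)) : (LinearMap.toMatrix' T).mulVecLin = T :=
  LinearMap.ext fun v => by rw [Matrix.mulVecLin_apply, LinearMap.toMatrix'_mulVec]

/-- **(3.65) BY CONSTRUCTION**: `X(c) = G + (G∘M_c)∘X(c)` whenever `1 − [G∘M_c]` is a unit. [cite: Balaban1985BackgroundPropagators, (3.65) p.403 (shape)] -/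
theorem bgProp_fix {G : (X → ℝ) →ₗ[ℝ] (X → ℝ)} {c : X → ℝ} (hunit : IsUnit (1 - LinearMap.toMatrix' (G ∘ₗ mulOp c))) :
    bgProp G c = G + (G ∘ₗ mulOp c) ∘ₗ bgProp G c := by
  unfold bgProp
  conv_lhs => rw [neumannSol_fix_of_isUnit hunit]
  rw [Matrix.mulVecLin_add, Matrix.mulVecLin_mul, mulVecLin_toMatrix', mulVecLin_toMatrix']

variable {G : (X → ℝ) →ₗ[ℝ] (X → ℝ)} {c : X → ℝ} {β δ r σ cr : ℝ}

omit [DecidableEq X] in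
/-- THE STEP `G∘M_c` has the majorant `β·r·e^{−δd}` from `G ≤ β·e^{−δd}` and `|c| ≤ r`. [cite: Balaban1985BackgroundPropagators, (3.63) p.402 (shape)] -/
theorem hasMaj_step (hβ : 0 ≤ β) (hr : 0 ≤ r)
    (hG : HasMaj (BlockNorm.ofBlocks g blk) (BlockNorm.ofBlocks g blk) G (fun y y' => β * Real.exp (-(δ * g.dist y y'))))
    (hc : ∀ x, |c x| ≤ r) :
    HasMaj (BlockNorm.ofBlocks g blk) (BlockNorm.ofBlocks g blk) (G ∘ₗ mulOp c) (fun y y' => β * r * Real.exp (-(δ * g.dist y y'))) := by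
  have hM := hasMaj_mulOp (g := g) blk (m := fun _ => r) (fun _ => hr) fun x => hc x
  have key := hasMaj_comp hG hM (fun _ _ => mul_nonneg hβ (Real.exp_nonneg _))
  refine key.mono fun a b => le_of_eq ?_
  rw [kappa_ofBlocks]
  simp only [one_mul]
  rw [sum_mul_diagK]
  ring

/-- Row sums of the step majorant: `≤ β·r·c_r` from (2.61) at a rate `σ ≤ δ`. [cite: Balaban1984PropagatorsII, Lemma 2.1 (2.61) p.234] -/
theorem rowSum_step (hd : ∀ a b : g.Site, 0 ≤ g.dist a b) (hrow : RowSum g σ cr) (hσδ : σ ≤ δ) (hβ : 0 ≤ β) (hr : 0 ≤ r) (y : g.Site) :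
    ∑ y', β * r * Real.exp (-(δ * g.dist y y')) ≤ β * r * cr := by
  rw [← Finset.mul_sum]
  exact mul_le_mul_of_nonneg_left ((hrow.mono hd hσδ) y) (mul_nonneg hβ hr)

/-- `1 − [G∘M_c]` IS A UNIT when `β·r·c_r < 1`. [cite: Balaban1985BackgroundPropagators, (3.63)–(3.64) pp.402–403 (mechanism)] -/
theorem isUnit_step (hd : ∀ a b : g.Site, 0 ≤ g.dist a b) (hrow : RowSum g σ cr) (hσδ : σ ≤ δ) (hβ : 0 ≤ β) (hr : 0 ≤ r)
    (hG : HasMaj (BlockNorm.ofBlocks g blk) (BlockNorm.ofBlocks g blk) G (fun y y' => β * Real.exp (-(δ * g.dist y y'))))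
    (hc : ∀ x, |c x| ≤ r) (hq : β * r * cr < 1) : IsUnit (1 - LinearMap.toMatrix' (G ∘ₗ mulOp c)) :=
  isUnit_one_sub_toMatrix' (hasMaj_step blk hβ hr hG hc) (fun _ _ => mul_nonneg (mul_nonneg hβ hr) (Real.exp_nonneg _))
    (rowSum_step hd hrow hσδ hβ hr) hq

/-- **THE NEUMANN MAJORANT OF THE CONSTRUCTED PROPAGATOR, WITH DECAY**: `X(c) ≤ β·(1 − β·r·c_r)⁻¹·e^{−ρd}` for every rate `0 ≤ ρ` with `ρ + σ ≤ δ`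
(`B9SectDWeightedNeumann.neumann_majorant_wrow` BY NAME; the a priori bound is automatic on the finite lattice). [cite: Balaban1985BackgroundPropagators, (3.64) p.403 (Neumann series, mechanism); Balaban1984PropagatorsII, (2.52)–(2.56) pp.232–233] -/
theorem hasMaj_bgProp (htri : Triangle254 g) (hd : ∀ a b : g.Site, 0 ≤ g.dist a b) (hrow : RowSum g σ cr) (hσ : 0 ≤ σ) {ρ : ℝ} (hρ : 0 ≤ ρ)
    (hρδ : ρ + σ ≤ δ) (hβ : 0 ≤ β) (hr : 0 ≤ r)
    (hG : HasMaj (BlockNorm.ofBlocks g blk) (BlockNorm.ofBlocks g blk) G (fun y y' => β * Real.exp (-(δ * g.dist y y'))))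
    (hc : ∀ x, |c x| ≤ r) (hq : β * r * cr < 1) :
    HasMaj (BlockNorm.ofBlocks g blk) (BlockNorm.ofBlocks g blk) (bgProp G c)
      (fun y y' => β * (1 - β * r * cr)⁻¹ * Real.exp (-(ρ * g.dist y y'))) := by
  have hσδ : σ ≤ δ := by linarith
  have hfix := bgProp_fix (isUnit_step blk hd hrow hσδ hβ hr hG hc hq)
  have hK := hasMaj_step blk hβ hr hG hc
  have hwrow : WRow g ρ (fun y y' => β * r * Real.exp (-(δ * g.dist y y'))) (β * r * cr) := wrow_of_exp hd hrow (mul_nonneg hβ hr) hρδ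
  have hS : HasMaj (BlockNorm.ofBlocks g blk) (BlockNorm.ofBlocks g blk) G (fun y y' => β * Real.exp (-(ρ * g.dist y y'))) :=
    hG.mono fun a b => mul_le_mul_of_nonneg_left (Real.exp_le_exp.mpr (by nlinarith [hd a b])) hβ
  obtain ⟨M₀, hM₀, hap⟩ := exists_const_hasMaj_ofBlocks (g := g) blk blk (bgProp G c)
  have hq1 : (BlockNorm.ofBlocks g blk).κ * (β * r * cr) < 1 := by rw [kappa_ofBlocks, one_mul]; exact hq
  have key := neumann_majorant_wrow htri hd hρ (fun _ _ => mul_nonneg (mul_nonneg hβ hr) (Real.exp_nonneg _)) hwrow hβ hM₀ hK hS hfix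
    hap hq1
  refine key.mono fun a b => le_of_eq ?_
  rw [kappa_ofBlocks, one_mul]

/-- THE COARSE `M_c∘X(c) ≤ r·β(1 − βrc_r)⁻¹·e^{−ρd}` — binder (c) of g0's background step. [cite: Balaban1985BackgroundPropagators, (3.63) p.402 (shape)] -/
theorem hasMaj_mulOp_bgProp (htri : Triangle254 g) (hd : ∀ a b : g.Site, 0 ≤ g.dist a b) (hrow : RowSum g σ cr) (hσ : 0 ≤ σ) {ρ : ℝ}
    (hρ : 0 ≤ ρ) (hρδ : ρ + σ ≤ δ) (hβ : 0 ≤ β) (hr : 0 ≤ r)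
    (hG : HasMaj (BlockNorm.ofBlocks g blk) (BlockNorm.ofBlocks g blk) G (fun y y' => β * Real.exp (-(δ * g.dist y y'))))
    (hc : ∀ x, |c x| ≤ r) (hq : β * r * cr < 1) :
    HasMaj (BlockNorm.ofBlocks g blk) (BlockNorm.ofBlocks g blk) (mulOp c ∘ₗ bgProp G c)
      (fun y y' => r * (β * (1 - β * r * cr)⁻¹) * Real.exp (-(ρ * g.dist y y'))) := by
  have hX := hasMaj_bgProp blk htri hd hrow hσ hρ hρδ hβ hr hG hc hq
  have hM := hasMaj_mulOp (g := g) blk (m := fun _ => r) (fun _ => hr) fun x => hc x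
  have hA0 : 0 ≤ β * (1 - β * r * cr)⁻¹ := mul_nonneg hβ (inv_nonneg.2 (by linarith))
  have key := hasMaj_comp hM hX (fun _ _ => diagK_nonneg (fun _ => hr) _ _)
  refine key.mono fun a b => le_of_eq ?_
  rw [kappa_ofBlocks]
  simp only [one_mul]
  rw [sum_diagK_mul]
  ring

end Propagator

/-! ## §3 The coefficients: the block average keeps the sup letter; the sandwiched coefficient defect from the oscillation letter -/

section Coefficients

variable {X X' : Type} [Fintype X'] [DecidableEq X]

/-- THE BLOCK AVERAGE KEEPS THE SUP LETTER: `|c′| ≤ r ⟹ |blockAvg π c′| ≤ r` (`r ≥ 0`; the empty-fibre junk value is `0`). [folklore] -/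
theorem abs_blockAvg_le (π : X' → X) {c' : X' → ℝ} {r : ℝ} (hr : 0 ≤ r) (hc' : ∀ x', |c' x'| ≤ r) (x : X) :
    |blockAvg π c' x| ≤ r := by
  unfold blockAvg
  rcases Nat.eq_zero_or_pos (fibre π x).card with h0 | hpos
  · rw [h0]; simpa using hr
  · have hcard : (0 : ℝ) < (fibre π x).card := by exact_mod_cast hpos
    rw [abs_div, abs_of_pos hcard, div_le_iff₀ hcard]
    calc |∑ x' ∈ fibre π x, c' x'| ≤ ∑ x' ∈ fibre π x, |c' x'| := Finset.abs_sum_le_sum_abs _ _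
      _ ≤ ∑ _x' ∈ fibre π x, r := Finset.sum_le_sum fun x' _ => hc' x'
      _ = r * (fibre π x).card := by rw [Finset.sum_const, nsmul_eq_mul, mul_comm]

variable [Fintype X] {g : B6.Geometry} (blk : X → g.Site) (π : X' → X)

/-- **BINDER (d) OF THE BACKGROUND STEP, DISCHARGED FROM THE OSCILLATION LETTER.**  For a fine piece `G′ ≤ β·e^{−δd}` (fine lattice blocked through the
pairing), a coarse operator `Xc ≤ A·e^{−ρd}` (`0 ≤ ρ`, `ρ + σ ≤ δ`, (2.54), (2.61) at `σ` with `c_r`) and a fine coefficient with `FibreOsc π c′ o` (constant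
`o ≥ 0`): `G′ ∘ 𝔇(M_{c′}, M_{blockAvg π c′}) ∘ Xc ≤ β·o·A·c_r·e^{−ρd}` — `T4EtaRateCoeffDefect.hasMaj_idef_mulOp_blockAvg` BY NAME between the two factors. [folklore] -/
theorem hasMaj_sandwich_blockAvg (htri : Triangle254 g) (hd : ∀ a b : g.Site, 0 ≤ g.dist a b) {σ cr : ℝ} (hrow : RowSum g σ cr)
    {ρ δ β A o : ℝ} (hρ : 0 ≤ ρ) (hρδ : ρ + σ ≤ δ) (hβ : 0 ≤ β) (hA : 0 ≤ A) (ho : 0 ≤ o)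
    {G' : (X' → ℝ) →ₗ[ℝ] (X' → ℝ)} {Xc : (X → ℝ) →ₗ[ℝ] (X → ℝ)} {c' : X' → ℝ}
    (hG' : HasMaj (BlockNorm.ofBlocks g (blk ∘ π)) (BlockNorm.ofBlocks g (blk ∘ π)) G' (fun y y' => β * Real.exp (-(δ * g.dist y y'))))
    (hXc : HasMaj (BlockNorm.ofBlocks g blk) (BlockNorm.ofBlocks g blk) Xc (fun y y' => A * Real.exp (-(ρ * g.dist y y'))))
    (hosc : FibreOsc π c' (fun _ => o)) :
    HasMaj (BlockNorm.ofBlocks g blk) (BlockNorm.ofBlocks g (blk ∘ π))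
      (G' ∘ₗ idef (pull π) (pull π) (mulOp c') (mulOp (blockAvg π c')) ∘ₗ Xc)
      (fun y y' => β * o * A * cr * Real.exp (-(ρ * g.dist y y'))) := by
  have hidef := hasMaj_idef_mulOp_blockAvg (g := g) blk π (o := fun _ => o) (fun _ => ho) (by simpa using hosc)
  have h1 := hasMaj_comp hG' hidef (fun _ _ => mul_nonneg hβ (Real.exp_nonneg _))
  have h1' : HasMaj (BlockNorm.ofBlocks g blk) (BlockNorm.ofBlocks g (blk ∘ π)) (G' ∘ₗ idef (pull π) (pull π) (mulOp c') (mulOp (blockAvg π c')))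
      (fun y y' => β * o * Real.exp (-(δ * g.dist y y'))) := by
    refine h1.mono fun a b => le_of_eq ?_
    rw [kappa_ofBlocks]
    simp only [one_mul]
    rw [sum_mul_diagK]
    ring
  have h2 := hasMaj_comp_exp (b₁ := BlockNorm.ofBlocks g blk) (b₂ := BlockNorm.ofBlocks g blk) (b₃ := BlockNorm.ofBlocks g (blk ∘ π))
    htri hd hrow (mul_nonneg hβ ho) hA hρ le_rfl hρδ h1' hXc
  have hop : G' ∘ₗ idef (pull π) (pull π) (mulOp c') (mulOp (blockAvg π c')) ∘ₗ Xc =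
      (G' ∘ₗ idef (pull π) (pull π) (mulOp c') (mulOp (blockAvg π c'))) ∘ₗ Xc := rfl
  rw [hop]
  refine h2.mono fun a b => le_of_eq ?_
  rw [kappa_ofBlocks]
  ring

end Coefficients

/-! ## §4 The η-defect of the constructed pair -/

section Defect

variable {X X' : Type} [Fintype X] [Fintype X'] [DecidableEq X] [DecidableEq X'] {g : B6.Geometry} (blk : X → g.Site) (π : X' → X)

/-- **THE η-DEFECT OF THE CONSTRUCTED BACKGROUND-DEPENDENT PAIR.**  Data: a [B6] carrier with (2.54), `d ≥ 0` and the (2.61) row sum at a rate `σ ≥ 0`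
with constant `c_r`; a coarse lattice `X` blocked by `blk`, a fine lattice `X′` paired to it by `π` and blocked through the pairing; `U ≡ 1` pieces `G`
(coarse), `G′` (fine) with block majorants `β·e^{−δd}` and the DEFECT majorant `𝔇(G′, G) ≤ m_G·e^{−δd}` through `(pull π, pull π)` (the -a layer, a
binder; `m_G ≥ 0` carries its rate factor); a fine coefficient `c′` with the (3.35) letter pair `|c′| ≤ r`, `FibreOsc π c′ o` (`r, o ≥ 0`; `o` carries its rate
factor); a rate `0 ≤ ρ` with `ρ + σ ≤ δ`; the smallness `q = β·r·c_r < 1` (the model's (3.63)).  Objects: the CONSTRUCTED propagators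
`X′ = bgProp G′ c′`, `X = bgProp G (blockAvg π c′)` ((3.64); (3.65) by `bgProp_fix`).  CONCLUSION:
`𝔇(X′, X) ≤ (m_G·c_r + m_G·c_r·(r·β(1−q)⁻¹) + β·o·(β(1−q)⁻¹)·c_r)·(1−q)⁻¹·e^{−ρd}` — g0's `idef_background_propagator_majorant_flat` with binders (b) step,
(c) `VX`, (d) sandwiched coefficient defect, (f) a priori ALL DISCHARGED; only the `U ≡ 1` layer `(β, δ, m_G)` and the letters `(r, o)` remain.
[cite: Balaban1985BackgroundPropagators, (3.63)–(3.65) pp.402–403 (mechanism); Balaban1984PropagatorsII, (2.52)–(2.56) pp.232–233, Lemma 2.1 (2.61) p.234] -/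
theorem hasMaj_idef_bgProp (htri : Triangle254 g) (hd : ∀ a b : g.Site, 0 ≤ g.dist a b) {σ cr : ℝ} (hσ : 0 ≤ σ) (hcr : 0 ≤ cr)
    (hrow : RowSum g σ cr) {ρ δ β r o mG : ℝ} (hρ : 0 ≤ ρ) (hρδ : ρ + σ ≤ δ) (hβ : 0 ≤ β) (hr : 0 ≤ r) (ho : 0 ≤ o) (hmG : 0 ≤ mG)
    {G : (X → ℝ) →ₗ[ℝ] (X → ℝ)} {G' : (X' → ℝ) →ₗ[ℝ] (X' → ℝ)} {c' : X' → ℝ}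
    (hG : HasMaj (BlockNorm.ofBlocks g blk) (BlockNorm.ofBlocks g blk) G (fun y y' => β * Real.exp (-(δ * g.dist y y'))))
    (hG' : HasMaj (BlockNorm.ofBlocks g (blk ∘ π)) (BlockNorm.ofBlocks g (blk ∘ π)) G' (fun y y' => β * Real.exp (-(δ * g.dist y y'))))
    (hDG : HasMaj (BlockNorm.ofBlocks g blk) (BlockNorm.ofBlocks g (blk ∘ π)) (idef (pull π) (pull π) G' G)
      (fun y y' => mG * Real.exp (-(δ * g.dist y y'))))
    (hc' : ∀ x', |c' x'| ≤ r) (hosc : FibreOsc π c' (fun _ => o)) (hq : β * r * cr < 1) :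
    HasMaj (BlockNorm.ofBlocks g blk) (BlockNorm.ofBlocks g (blk ∘ π))
      (idef (pull π) (pull π) (bgProp G' c') (bgProp G (blockAvg π c')))
      (fun y y' => (mG * cr + 1 * (mG * cr) * (r * (β * (1 - β * r * cr)⁻¹)) + β * o * (β * (1 - β * r * cr)⁻¹) * cr) *
        (1 - 1 * (β * r * cr))⁻¹ * Real.exp (-(ρ * g.dist y y'))) := by
  have hσδ : σ ≤ δ := by linarith
  have hc : ∀ x, |blockAvg π c' x| ≤ r := abs_blockAvg_le π hr hc'
  have hq' : 0 < 1 - β * r * cr := by linarith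
  have hAX : 0 ≤ β * (1 - β * r * cr)⁻¹ := mul_nonneg hβ (inv_nonneg.2 hq'.le)
  -- the two fixed-point equations (3.65), by construction
  have hfix := bgProp_fix (isUnit_step blk hd hrow hσδ hβ hr hG hc hq)
  have hfix' := bgProp_fix (isUnit_step (blk ∘ π) hd hrow hσδ hβ hr hG' hc' hq)
  -- (b) the fine step and its weighted row norm
  have hK' := hasMaj_step (blk ∘ π) hβ hr hG' hc'
  have hwrow' : WRow g ρ (fun y y' => β * r * Real.exp (-(δ * g.dist y y'))) (β * r * cr) := wrow_of_exp hd hrow (mul_nonneg hβ hr) hρδ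
  -- (a) the U ≡ 1 defect's weighted row norm
  have hwrowG : WRow g ρ (fun y y' => mG * Real.exp (-(δ * g.dist y y'))) (mG * cr) := wrow_of_exp hd hrow hmG hρδ
  -- (c) the coarse VX
  have hVX := hasMaj_mulOp_bgProp blk htri hd hrow hσ hρ hρδ hβ hr hG hc hq
  -- (d) the sandwiched coefficient defect
  have hX := hasMaj_bgProp blk htri hd hrow hσ hρ hρδ hβ hr hG hc hq
  have hDV := hasMaj_sandwich_blockAvg blk π htri hd hrow hρ hρδ hβ hAX ho hG' hX hosc
  -- (f) a priori
  obtain ⟨M₀, hM₀, hap⟩ := exists_const_hasMaj_ofBlocks (g := g) blk (blk ∘ π)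
    (idef (pull π) (pull π) (bgProp G' c') (bgProp G (blockAvg π c')))
  have hq2 : (BlockNorm.ofBlocks g (blk ∘ π)).κ * (β * r * cr) < 1 := by rw [kappa_ofBlocks, one_mul]; exact hq
  -- THE BACKGROUND STEP (g0 file 5, flat weights)
  have key := idef_background_propagator_majorant_flat (b₁ := BlockNorm.ofBlocks g blk) (b₂' := BlockNorm.ofBlocks g (blk ∘ π))
    (τ₁ := pull π) (τ₂ := pull π) (G₁ := G) (Xc := bgProp G (blockAvg π c')) (V := mulOp (blockAvg π c')) (G₁' := G')
    (Xf := bgProp G' c') (V' := mulOp c') (ρ := ρ) htri hd hρ (mul_nonneg hr hAX)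
    (mul_nonneg (mul_nonneg (mul_nonneg hβ ho) hAX) hcr) hM₀
    (fun _ _ => mul_nonneg (mul_nonneg hβ hr) (Real.exp_nonneg _)) hwrow' (fun _ _ => mul_nonneg hmG (Real.exp_nonneg _)) hwrowG
    hfix hfix' hK' hVX hDG hDV hap hq2
  refine key.mono fun a b => le_of_eq ?_
  rfl

end Defect

end Summit.QuantumFields.YangMills.BalabanUVNodes.N15.BackgroundLayer
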